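import Literature.AnabelianGeometry.SemiGraphs.TemperedAnabelianTowerWitness
import Literature.AnabelianGeometry.SemiGraphs.TemperedProfiniteProducts
import Mathlib.FieldTheory.Galois.Profinite
import HarnessLib

/-!
# Non-vacuity of "tempered + virtually free tower" JOINTLY with the [SemiAnbd] §6 interface

Mochizuki, *Semi-graphs of anabelioids*, Publ. RIMS **42** (2006) [SemiAnbd], §6 pp. 69–71.
[cite: MochizukiSemiAnbd2006, §6 pp.69-71]

VACUITY-LANE companion (abc-iut cell, prover abc-iut-w5-d240; theorems only, no definitions) of
`TemperedAnabelianTowerWitness.lean`.  The in-cone closers of [SemiAnbd] Theorems 6.4 / 6.6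
(`temperedAnabelianTheorem_of_tower`, `profiniteOuterIsoLiftsHolds_of_tower`) quantify over data
`Y : TemperedCurve p` carrying `IsTempered Y.PiTemp` and the tower input `htower₀`.  This file
kernel-checks that these two hypotheses are satisfiable TOGETHER WITH the axioms of the interface
`TemperedCurve p`: `exists_temperedCurve_isTempered_tower` exhibits `X : TemperedCurve p` with
`K = ℚ_p`, `Π^temp := F₂ × G_{ℚ_p}` (`F₂` the discrete free group of rank two, augmentation = second
projection), `Π := F̂₂ × G_{ℚ_p}`, no closed points — tempered, with the tower input, and NOT compact
(so not covered by the profinite degenerate inhabitant of `TemperedAnabelianWitness.lean`).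

Ingredients: `isTempered_of_discreteTopology`, `tower_of_isFreeGroup` (`TemperedAnabelianTowerWitness`),
`isProfiniteCompletion_toProfiniteCompletion` (`ProfiniteCompletionModel`), and the product lemmas
`IsProfiniteCompletion.prodMap_id`, `IsTempered.prod_of_profinite`, `tower_prod_of_profinite`
(`TemperedProfiniteProducts`).

HONEST LIMITS: consistency evidence only; `F₂ × G_{ℚ_p}` is not the tempered fundamental group of a
curve (a hyperbolic curve has closed points, and its geometric tempered fundamental group is not a
direct factor).  Nothing here concerns the disputed parts of inter-universal Teichmüller theory or
takes a side on [IUTchIII] Cor. 3.12.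
-/

noncomputable section

namespace Literature.AnabelianGeometry.SemiGraphs

open CategoryTheory ProfiniteGrp ProfiniteGrp.ProfiniteCompletion
open _root_.Topology



/-! ### The curve-level witness -/

section Curve

variable (p : ℕ) [Fact p.Prime]

/-- **`IsTempered` and the tower input `htower₀` are jointly satisfiable with the axioms of the §6
interface `TemperedCurve p`, by a NON-compact datum**: `K = ℚ_p`, `Π^temp := F₂ × G_{ℚ_p}` (`F₂` the
discrete free group of rank two), augmentation the second projection, `Π := F̂₂ × G_{ℚ_p}`, no closed
points.  Hence the in-cone closers `temperedAnabelianTheorem_of_tower` / `profiniteOuterIsoLiftsHolds_of_tower`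
([SemiAnbd] Thms. 6.4 / 6.6 over the tower) do not quantify vacuously.  Consistency evidence only; not
a curve. [cite: MochizukiSemiAnbd2006, §6 pp.69-71] -/
theorem exists_temperedCurve_isTempered_tower :
    ∃ X : TemperedCurve p, IsTempered X.PiTemp ∧ ¬ CompactSpace X.PiTemp ∧
      ∀ U ∈ 𝓝 (1 : X.PiTemp), ∃ N : OpenNormalSubgroup X.PiTemp, (N : Set X.PiTemp) ⊆ U ∧
        ∃ (G : Subgroup (X.PiTemp ⧸ N.toSubgroup)) (_ : IsFreeGroup G), G.Normal ∧ G.FiniteIndex ∧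
          Finite (IsFreeGroup.Generators G) ∧ ∃ a ∈ G, ∃ b ∈ G, a * b ≠ b * a := by
  letI : TopologicalSpace (FreeGroup (Fin 2)) := ⊥
  haveI : DiscreteTopology (FreeGroup (Fin 2)) := ⟨rfl⟩
  haveI : IsTopologicalGroup (FreeGroup (Fin 2)) := ⟨⟩
  haveI : IsGalois ℚ_[p] (AlgebraicClosure ℚ_[p]) := {}
  haveI : T2Space (GQp p) := krullTopology_t2
  haveI : Finite (IsFreeGroup.Generators (FreeGroup (Fin 2))) :=
    Finite.of_equiv (Fin 2) (Equiv.ofFreeGroupEquiv (IsFreeGroup.toFreeGroup (FreeGroup (Fin 2))))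
  let η : FreeGroup (Fin 2) →ₜ* completion (GrpCat.of (FreeGroup (Fin 2))) :=
    { toMonoidHom := toProfiniteCompletion (FreeGroup (Fin 2))
      continuous_toFun := continuous_of_discreteTopology }
  have hη : IsProfiniteCompletion η := isProfiniteCompletion_toProfiniteCompletion (FreeGroup (Fin 2))
  haveI := Literature.GroupTheory.CombinatorialGroupTheory.freeGroup_residuallyFinite (Fin 2)
  have hηinj : Function.Injective η := toProfiniteCompletion_injective
  let X : TemperedCurve p :=
    { K := ⊥
      finiteDimensional_K := inferInstance
      PiTemp := FreeGroup (Fin 2) × GQp p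
      aug := ContinuousMonoidHom.snd (FreeGroup (Fin 2)) (GQp p)
      range_aug := by
        rw [IntermediateField.fixingSubgroup_bot]
        exact MonoidHom.range_eq_top.mpr Prod.snd_surjective
      PiHat := completion (GrpCat.of (FreeGroup (Fin 2))) × GQp p
      toHat := η.prodMap (ContinuousMonoidHom.id (GQp p))
      isProfiniteCompletion_toHat := hη.prodMap_id
      toHat_injective := hηinj.prodMap Function.injective_id
      augHat := ContinuousMonoidHom.snd _ (GQp p)
      augHat_comp := fun _ => rfl
      Pt := PEmpty
      IsCusp := fun x => x.elim
      decomp := fun x => x.elim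
      isClosed_decomp := fun x => x.elim
      isOpen_aug_decomp := fun x => x.elim
      inertia_eq_bot := fun x => x.elim
      inertia_equiv_zHat := fun x => x.elim }
  refine ⟨X, isTempered_of_discreteTopology.prod_of_profinite, ?_, tower_prod_of_profinite
    (tower_of_isFreeGroup ⟨FreeGroup.of 0, FreeGroup.of 1, ?_⟩)⟩
  · -- `F₂ × G_{ℚ_p}` is not compact: its closed discrete subgroup `F₂ × 1` would be finite
    intro hc
    have hcl : IsClosed (Set.range (fun f : FreeGroup (Fin 2) => ((f, 1) : FreeGroup (Fin 2) × GQp p))) := by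
      have : Set.range (fun f : FreeGroup (Fin 2) => ((f, 1) : FreeGroup (Fin 2) × GQp p)) =
          Prod.snd ⁻¹' {1} := by
        ext ⟨f, g⟩
        simp only [Set.mem_range, Prod.mk.injEq, Set.mem_preimage, Set.mem_singleton_iff]
        constructor
        · rintro ⟨f', -, rfl⟩; rfl
        · intro hg; exact ⟨f, rfl, hg.symm⟩
      rw [this]
      exact (isClosed_singleton).preimage continuous_snd
    have hcomp : IsCompact (Set.range (fun f : FreeGroup (Fin 2) =>
        ((f, 1) : FreeGroup (Fin 2) × GQp p))) := hcl.isCompact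
    have hemb : Topology.IsClosedEmbedding (fun f : FreeGroup (Fin 2) =>
        ((f, 1) : FreeGroup (Fin 2) × GQp p)) :=
      Topology.IsClosedEmbedding.of_continuous_injective_isClosedMap continuous_of_discreteTopology
        (fun a b h => (Prod.mk.inj h).1) (fun s _ => by
          have : (fun f : FreeGroup (Fin 2) => ((f, 1) : FreeGroup (Fin 2) × GQp p)) '' s =
              (Prod.fst ⁻¹' s) ∩ Prod.snd ⁻¹' {1} := by
            ext ⟨f, g⟩
            simp only [Set.mem_image, Prod.mk.injEq, Set.mem_inter_iff, Set.mem_preimage,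
              Set.mem_singleton_iff]
            constructor
            · rintro ⟨f', hf', rfl, rfl⟩; exact ⟨hf', rfl⟩
            · rintro ⟨hf, hg⟩; exact ⟨f, hf, rfl, hg.symm⟩
          rw [this]
          exact ((isOpen_discrete s).isClosed_compl.isOpen_compl |> fun _ =>
            (isClosed_discrete s).preimage continuous_fst).inter
            ((isClosed_singleton).preimage continuous_snd))
    haveI : CompactSpace (FreeGroup (Fin 2)) := hemb.compactSpace
    haveI : Finite (FreeGroup (Fin 2)) := finite_of_compact_of_discrete
    exact not_finite (FreeGroup (Fin 2))
  · intro h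
    let f : FreeGroup (Fin 2) →* Equiv.Perm (Fin 3) :=
      FreeGroup.lift ![Equiv.swap 0 1, Equiv.swap 1 2]
    have h2 := congrArg f h
    simp only [map_mul, f, FreeGroup.lift_apply_of] at h2
    exact absurd h2 (by decide)

end Curve

end Literature.AnabelianGeometry.SemiGraphs

end
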